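import Summits.QuantumFields.YangMills.Theorems.AllWindowsColdBoxBoxHighLineTiltCum5SizesBeta
import Summits.QuantumFields.YangMills.Theorems.AllWindowsColdBoxBoxHighLineTiltThirdOrderMuD

/-!
# U5 step (e5′) in β-LETTERS over `μ_D` — `|Cov₁ − Cov₀ − κ₃,₀ − κ₄,₀/2| ≤ K/6` with `K` = the discharged κ₅ bound (record for the sub-window `θ < 5/52`)
# (`Cruxes/BoxWindowHighSU2213/ASSEMBLY-U5.md` §3; LINE-20 U5 ⟨stmt-QuantumFields-24336⟩)

Width seat `ym-line-sfw-p2-w5` (prover-ym-line-sfw-p2-w5-g24-0).  Composition, BY NAME, of fcl-p3 g27's ✓13u³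
`GaussNormalForm.abs_tiltCov_sub_sub_tiltCum3_sub_half_tiltCum4_le_muD_chartPlaqCost` (third-order Taylor of the tilted covariance over `μ_D` along the
untruncated `tiltU`) with this seat's ✓`exists_beta0_abs_tiltCum5_muD_le` (the κ₅ size in β-letters, `…TiltCum5SizesBeta`) and ✓`TiltSup.exists_forall_abs_tiltU_le_wide`:

* ★★ `GaussNormalForm.exists_beta0_abs_tiltCov_third_order_le` — for `0 < θ`, `5θ < 1`, `0 < κ₃ < (1/2 − 4θ)/3`: `∃ C ≥ 0, m, β₀ ≥ 1, ∀ β ≥ β₀, ∀ H`,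
  `1 ≤ H ≤ β^θ + 1, ∀ x y`, at `s = β^{−1/2+κ₃}`,
  `|tiltCov μ_D U 1 c_x c_y − tiltCov μ_D U 0 c_x c_y − tiltCum3 μ_D U 0 c_x c_y − tiltCum4 μ_D U 0 c_x c_y / 2| ≤ C·(1+log H)^m·(((1+log H)²/β² + s³/(β√β))·(H⁶/(β√β)))/6`.

Planner ym-idea-2 g18's ruling 00:19:54Z: the no-cut hypothesis set (a) `κ₃ < (1/2 − 4θ)/3` serves `θ < 5/52` of U5's HIGH window; the full-window (CUT) version is the
composition of w2 g33's 13u³′ over `μ_{D′}` with this seat's ✓`exists_beta0_abs_tiltCum5_muSet_le` (`…TiltCum5SizesMuSetU`).  Everything proved; no definitions;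
standard axioms.  HONEST LABEL: U5 prep, helper-grade; U5 ⟨24336⟩ UNSTAFFED/OPEN, ⟨24004⟩ OPEN; route AllWindowsColdBox DRAFT; no crux, rung or summit is proved;
**the Yang–Mills mass gap is NOT proved by this file; no summit is proved by a line.**
-/

set_option autoImplicit false

noncomputable section

open MeasureTheory Set Real
open Literature.Probability.LatticeModels (Site)

namespace Summit.QuantumFields.YangMills.Theorems.AllWindowsColdBoxBoxHighLine

namespace GaussNormalForm

/-- ★★ **U5's step (e5′) over `μ_D` in β-letters, every hypothesis discharged** (window `0 < θ`, `5θ < 1`, `0 < κ₃ < (1/2 − 4θ)/3`; `U = tiltU β H`,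
`c_z = chartPlaqCost H z 1 2`, `s = β^{−1/2+κ₃}`, `μ_D = (volume.restrict (smallField H s)).withDensity (ofReal ∘ gaussWeight β H)`). -/
theorem exists_beta0_abs_tiltCov_third_order_le {θ κ₃ : ℝ} (hθ : 0 < θ) (hθ5 : 5 * θ < 1) (hκ0 : 0 < κ₃) (hκu : κ₃ < (1 / 2 - 4 * θ) / 3) :
    ∃ C : ℝ, ∃ m : ℕ, 0 ≤ C ∧ ∃ β₀ : ℝ, 1 ≤ β₀ ∧ ∀ β : ℝ, β₀ ≤ β → ∀ H : ℕ, 1 ≤ H → (H : ℝ) ≤ β ^ θ + 1 → ∀ (x y : Site 4),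
      |Tilt.tiltCov (((volume : Measure (LandauFree H → E3)).restrict (smallField H (β ^ (-1 / 2 + κ₃)))).withDensity
              fun a => ENNReal.ofReal (gaussWeight β H a)) (tiltU β H) 1 (chartPlaqCost H x 1 2) (chartPlaqCost H y 1 2) -
          Tilt.tiltCov (((volume : Measure (LandauFree H → E3)).restrict (smallField H (β ^ (-1 / 2 + κ₃)))).withDensity
              fun a => ENNReal.ofReal (gaussWeight β H a)) (tiltU β H) 0 (chartPlaqCost H x 1 2) (chartPlaqCost H y 1 2) -
          Tilt.tiltCum3 (((volume : Measure (LandauFree H → E3)).restrict (smallField H (β ^ (-1 / 2 + κ₃)))).withDensity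
              fun a => ENNReal.ofReal (gaussWeight β H a)) (tiltU β H) 0 (chartPlaqCost H x 1 2) (chartPlaqCost H y 1 2) -
          Tilt.tiltCum4 (((volume : Measure (LandauFree H → E3)).restrict (smallField H (β ^ (-1 / 2 + κ₃)))).withDensity
              fun a => ENNReal.ofReal (gaussWeight β H a)) (tiltU β H) 0 (chartPlaqCost H x 1 2) (chartPlaqCost H y 1 2) / 2| ≤
        C * (1 + Real.log H) ^ m *
            (((1 + Real.log H) ^ 2 / β ^ 2 + (β ^ (-1 / 2 + κ₃)) ^ 3 / (β * Real.sqrt β)) * ((H : ℝ) ^ 6 / (β * Real.sqrt β))) / 6 := by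
  obtain ⟨C, m, hC, β₀, hβ₀, hK⟩ := exists_beta0_abs_tiltCum5_muD_le hθ hθ5 hκ0 hκu
  obtain ⟨b₃, hb₃1, hb₃⟩ := TiltSup.exists_forall_abs_tiltU_le_wide hθ hθ5 hκu one_pos
  refine ⟨C, m, hC, max β₀ b₃, le_max_of_le_left hβ₀, fun β hβ H hH hHu x y => ?_⟩
  have hβ1 : β₀ ≤ β := (le_max_left _ _).trans hβ
  have hβ3 : b₃ ≤ β := (le_max_right _ _).trans hβ
  have hβ0 : 0 < β := lt_of_lt_of_le one_pos (hβ₀.trans hβ1)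
  have hs : 0 < β ^ (-1 / 2 + κ₃) := Real.rpow_pos_of_pos hβ0 _
  exact abs_tiltCov_sub_sub_tiltCum3_sub_half_tiltCum4_le_muD_chartPlaqCost hβ0 hs (hb₃ β hβ3 H hH hHu) x y (hK β hβ1 H hH hHu x y)

end GaussNormalForm

end Summit.QuantumFields.YangMills.Theorems.AllWindowsColdBoxBoxHighLine

end
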